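import Summits.BirchSwinnertonDyer.BirchSwinnertonDyer.Theorems.ErratumRoadFiveTwoVariableControlInputs
import Literature.NumberTheory.EllipticCurves.BigRepModuleShiftStructureProofs
import Literature.NumberTheory.GaloisRepresentations.ContinuousCohomologyAdditiveTransport
import Summits.BirchSwinnertonDyer.Rank1Residual.X11b.SelmerTorsionControl
import HarnessLib

/-!
# Two-variable CONTROL ([JSW17, Lemma 3.4.1]), Selmer side: the injection
# `Sel_L(M) ↪ Sel_L(𝓜)[T_c]` for the ITERATED big representation, with its exact range
# (helper, `--supports stmt-BirchSwinnertonDyer-25505`)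

Cell `bsd-stepL`, seat `bsd-stepL-imc-p1` (prover g21, 2026-08-28). Theorems only (no definition, no
named fact, no `sorry`, no instance, no notation). Fourth file of the `complete` cut of crux 25505
`ErratumThm23SigmaLe` along the registered line `erratum_chain` (after
`ErratumRoadFiveTwoVariableCharIdealDescent` = the algebra of [JSW17, Cor. 3.4.2],
`ErratumRoadFiveErratumThm23OfTwoVariable` = the registered stub `stub_JSW_sigmaDescent` FROM CONTROL,
`ErratumRoadFiveTwoVariableControlInputs` = `hr`, `hglob` and the defect criterion at `r = T_c`).

## What is proved

Setting (generic): a topological group `Γ`, a discrete `𝒪`-module `A` with a continuous `𝒪`-linear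
action `ρ`, two characters `κa κc : Γ →ₜ* ℤ_p`, a family of local maps `φ_v : Γ_v → Γ` and a
constrained set `L`. Write `M = bigRep κa ρ` (the one-variable big representation, a discrete
`Λ = 𝒪⟦T⟧`-module: smooth `p`-primary functions `ℤ_p → A`) and `𝓜 = bigRep κc M` (the ITERATE, a
discrete `Λ_K = Λ⟦X⟧ = 𝒪⟦T_a⟧⟦T_c⟧`-module; for `Γ = Γ_K`, `κa` anticyclotomic and `κc` cyclotomic
this is the erratum's ∕ [JSW17]'s `T ⊗ Λ_K^*` over the `ℤ_p²`-extension, `X = T_c = γ₊ − 1`).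

* §1 **Constants.** The constant function `x ↦ m` (`m ∈ M`) is an element of `𝓜` killed by
  `X` (`const_mem`, `const_mem_torsionBy`); every element of `𝓜[X]` is the constant function at its
  value at `0` (`eq_const_of_mem_torsionBy`); `C f • const m = const (f • m)` (`C_smul_const`). With the
  tree's `bigRep_mk_const` (`g · const m = const (g · m)`) this says: **`𝓜[X] = M`** as topological
  `Γ`-modules, the `Λ`-structure of `M` matching the CONSTANTS `C : Λ → Λ⟦X⟧` on `𝓜[X]`
  ("`M = 𝓜[γ₊ − 1]`", [JSW17] p. 14).
* §2 **`exists_controlHom`.** If `A` has no non-zero `Γ`-fixed `p`-power-torsion element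
  ((irr_K)), there is an additive INJECTIVE map `θ : Sel_L(M) → Sel_L(𝓜)`, `C`-semilinear
  (`θ (f • s) = C f • θ s`), whose range is EXACTLY `H¹(ι)(Sel_L(𝓜[X]))` (`ι : 𝓜[X] ⊂ 𝓜`) — the map
  "`H¹_{ac}(K, M) ↪ H¹_{Gr}(K, 𝓜)[γ₊ − 1]`" of [JSW17, (before Lemma 3.4.1)]. Construction: the
  constants give an equivariant continuous additive equivalence `η : M ≃ₜ+ 𝓜[X]` ACROSS the two
  scalar rings; the tree's scalar-blind transport `continuousCohomologyAddEquiv η`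
  (`ContinuousCohomologyAdditiveTransport.lean`) identifies `H¹(Γ, M) ≃+ H¹(Γ, 𝓜[X])`, and its
  naturality (`continuousCohomologyAddEquiv_map`) along the `φ_v` matches the Selmer conditions and
  along the scalar endomorphisms gives `C`-semilinearity; composing with the `Λ_K`-linear
  `H¹(ι) = torsionInclH1 𝓜 X` (injective because `𝓜^Γ = 0`, `ControlInputs.bigRep_bigRep_invariants_eq_bot`,
  and `X` is onto `𝓜`, `ControlInputs.X_smul_surjective_iterate`) gives `θ`.

With the tree's `TorsionControl.map_torsionInclH1_selmer` (range `= Sel_L(𝓜) ∩ H¹(Γ, 𝓜)[X]` under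
`X`-divisible constrained local invariants) this is the whole Selmer side of the control; the
Pontryagin-dual side (`X(𝓜)/X ↠ X(M)`, kernel, finite generation) is the sequel
`ErratumRoadFiveTwoVariableControlDual.lean`, and the instantiation at `(Γ_K, localMap K, strictSet)`
is `ErratumRoadFiveTwoVariableControl.lean`.

HONEST FRAMING: generic algebra ∕ cohomological bookkeeping on the tree's constructed carriers; nothing
about any newform or curve is asserted; BSD is proved for no pair; closes: none (T7).

## References
* [JetchevSkinnerWan2017] §3.4, the display before Lemma 3.4.1 and Lemma 3.4.1 (arXiv:1512.06894
  p. 14: "We have `M = 𝓜[γ₊ − 1]` and, by (irr_K), `H¹(K^S/K, M) ≅ H¹(K^S/K, 𝓜)[γ₊ − 1]`, which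
  induces maps `H¹_{ac^Σ}(K, M) ↪ H¹_{Gr^Σ}(K, 𝓜)[γ₊ − 1]` …").
* [Castella2018Erratum] Lemma 2.1 (p. 2) — the one-variable instance of the same control.
* [GreenbergLNM1716] §4, before Prop. 4.10 (`𝒜[T] ≅ Hom(Λ/ΛT, A) = A`, the constants).
* [Brown1982CohomologyGroups] III.1 Ex. 3; [SerreGaloisCohomology1997] I §2.2 (cochains do not see the scalars).
-/

noncomputable section

open CategoryTheory Literature.NumberTheory.GaloisRepresentations Literature.NumberTheory.EllipticCurves
  Summit.BirchSwinnertonDyer.Rank1Residual.X11b.TorsionControl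
open scoped ContRepresentation

-- D-0017: single-problem summit, the namespace repeats the problem name by design.
set_option linter.dupNamespace false
set_option autoImplicit false

namespace Summit.BirchSwinnertonDyer.BirchSwinnertonDyer.Theorems.ErratumThm23TwoVariable.ControlHom

universe u

/-! ## §1 The constants `M ⊂ 𝓜`: `𝓜[X]` is the module of constant functions -/

section Constants

variable {𝒪 : Type*} [CommRing 𝒪] {p : ℕ} [Fact p.Prime] {A : Type u} [AddCommGroup A] [Module 𝒪 A]

/-- The constant function `x ↦ m` at an element `m` of the one-variable big module `M` is a smooth
`p`-primary function `ℤ_p → M`, i.e. an element of the iterate `𝓜` (`m` is `p`-power torsion).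
[cite: GreenbergLNM1716, §4, before Prop. 4.10 (𝒜[θ] ≅ Hom(Λ/Λθ, ·); θ = T: the constants)] -/
theorem const_mem (m : BigRepModule 𝒪 p A) :
    (fun _ : ℤ_[p] ↦ m) ∈ bigRepSubmodule (PowerSeries 𝒪) p (BigRepModule 𝒪 p A) := by
  rw [BigRepModule.const_mem_bigRepSubmodule_iff]
  obtain ⟨k, hk⟩ := m.exists_torsion
  exact ⟨k, BigRepModule.ext fun x ↦ by rw [BigRepModule.nsmul_apply, hk, BigRepModule.zero_apply]⟩

/-- The constant function at `m` is killed by the outer variable `X = T_c` (`X` acts as `τ₁ − 1`).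
[cite: GreenbergLNM1716, §4, before Prop. 4.10 (𝒜[T] = the constants)] -/
theorem const_mem_torsionBy (m : BigRepModule 𝒪 p A) :
    BigRepModule.mk (fun _ : ℤ_[p] ↦ m) (const_mem m) ∈
      Submodule.torsionBy (PowerSeries (PowerSeries 𝒪))
        (BigRepModule (PowerSeries 𝒪) p (BigRepModule 𝒪 p A)) PowerSeries.X := by
  rw [Submodule.mem_torsionBy_iff, BigRepModule.X_smul]
  exact BigRepModule.shiftSubOne_mk_const m (const_mem m)

/-- **`𝓜[X]` consists of constant functions**: an element of the iterate killed by `X` is the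
constant function at its value at `0` ("`M = 𝓜[γ₊ − 1]`").
[cite: JetchevSkinnerWan2017, §3.4 (arXiv:1512.06894 p. 14, "M = 𝓜[γ₊ − 1]")]
[cite: GreenbergLNM1716, §4, before Prop. 4.10] -/
theorem eq_const_of_mem_torsionBy
    (Φ : Submodule.torsionBy (PowerSeries (PowerSeries 𝒪))
        (BigRepModule (PowerSeries 𝒪) p (BigRepModule 𝒪 p A)) PowerSeries.X) :
    (Φ : BigRepModule (PowerSeries 𝒪) p (BigRepModule 𝒪 p A)) =
      BigRepModule.mk (fun _ : ℤ_[p] ↦ (Φ : BigRepModule (PowerSeries 𝒪) p (BigRepModule 𝒪 p A)) 0)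
        (const_mem _) := by
  have h := Φ.2
  rw [Submodule.mem_torsionBy_iff, BigRepModule.X_smul] at h
  exact BigRepModule.ext fun x ↦ by
    rw [BigRepModule.mk_apply]
    exact BigRepModule.apply_eq_apply_zero_of_shiftSubOne_eq_zero _ h x

/-- The `Λ`-structure of `M` is the CONSTANTS structure on `𝓜[X]`: `C f • const m = const (f • m)`
(`C : Λ → Λ⟦X⟧`; on the iterate `C f` acts through the pointwise `Λ`-action, `BigRepModule.C_smul`).
[cite: JetchevSkinnerWan2017, §3.4 (Λ = Λ_K/(γ₊ − 1) acting on M = 𝓜[γ₊ − 1])] -/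
theorem C_smul_const (f : PowerSeries 𝒪) (m : BigRepModule 𝒪 p A) :
    (PowerSeries.C f : PowerSeries (PowerSeries 𝒪)) •
        BigRepModule.mk (fun _ : ℤ_[p] ↦ m) (const_mem m) =
      BigRepModule.mk (fun _ : ℤ_[p] ↦ f • m) (const_mem (f • m)) := by
  rw [BigRepModule.C_smul]
  exact BigRepModule.ext fun x ↦ by
    rw [BigRepModule.smul_apply, BigRepModule.mk_apply, BigRepModule.mk_apply]

end Constants

/-! ## §2 The control injection `θ : Sel_L(M) ↪ Sel_L(𝓜)` and its range `H¹(ι)(Sel_L(𝓜[X]))` -/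

section Control

variable {𝒪 : Type*} [CommRing 𝒪] [TopologicalSpace 𝒪] {p : ℕ} [Fact p.Prime]
  {A : Type u} [AddCommGroup A] [Module 𝒪 A] [TopologicalSpace A] [DiscreteTopology A]
  {Γ : Type u} [Group Γ] [TopologicalSpace Γ] [IsTopologicalGroup Γ]
  [TopologicalSpace (PowerSeries 𝒪)] [TopologicalSpace (PowerSeries (PowerSeries 𝒪))]
  [ContinuousSMul (PowerSeries 𝒪) (BigRepModule 𝒪 p A)]
  [ContinuousSMul (PowerSeries (PowerSeries 𝒪))
    (BigRepModule (PowerSeries 𝒪) p (BigRepModule 𝒪 p A))]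
  {ι : Type*} {Γv : ι → Type u} [∀ v, Group (Γv v)] [∀ v, TopologicalSpace (Γv v)]
  [∀ v, IsTopologicalGroup (Γv v)] (φ : ∀ v, Γv v →ₜ* Γ) (L : Set ι)
  (κc κa : Γ →ₜ* Multiplicative ℤ_[p]) (ρ : ContinuousRep Γ 𝒪 A)

/-- **The control injection** ([JSW17], display before Lemma 3.4.1: "`M = 𝓜[γ₊ − 1]` and, by
(irr_K), `H¹(K^S/K, M) ≅ H¹(K^S/K, 𝓜)[γ₊ − 1]`, which induces maps
`H¹_{ac^Σ}(K, M) ↪ H¹_{Gr^Σ}(K, 𝓜)[γ₊ − 1]`"). For the iterate `𝓜 = bigRep κc (bigRep κa ρ)` over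
`Λ⟦X⟧` and `M = bigRep κa ρ` over `Λ = 𝒪⟦T⟧`, with `A` free of non-zero `Γ`-fixed `p`-power-torsion
elements, there is an additive map `θ : Sel_L(M) → Sel_L(𝓜)` which is
(1) injective, (2) `C`-semilinear (`θ (f • s) = C f • θ s`), (3) valued in `H¹(ι)(Sel_L(𝓜[X]))`, and
(4) ONTO `H¹(ι)(Sel_L(𝓜[X]))` (every Selmer class of `𝓜` coming from a Selmer class of `𝓜[X]` is a
value of `θ`). It is `H¹(ι) ∘ η_*` for the constants equivalence `η : M ≃ₜ+ 𝓜[X]` (§1) transported to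
`H¹` by the tree's scalar-blind `continuousCohomologyAddEquiv`.
[cite: JetchevSkinnerWan2017, §3.4 and Lemma 3.4.1 (arXiv:1512.06894 p. 14)]
[cite: Castella2018Erratum, Lemma 2.1 (p. 2)] -/
theorem exists_controlHom
    (hA : ∀ a : A, (∀ g : Γ, ρ g a = a) → (∃ k : ℕ, p ^ k • a = 0) → a = 0) :
    ∃ θ : selmer φ L (bigRep (p := p) κa ρ) →+
        selmer φ L (bigRep (p := p) κc (bigRep (p := p) κa ρ)),
      Function.Injective θ ∧
      (∀ (f : PowerSeries 𝒪) (s : selmer φ L (bigRep (p := p) κa ρ)),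
        θ (f • s) = (PowerSeries.C f : PowerSeries (PowerSeries 𝒪)) • θ s) ∧
      (∀ s, ((θ s : selmer φ L (bigRep (p := p) κc (bigRep (p := p) κa ρ))) :
          continuousCohomology 1 (bigRep (p := p) κc (bigRep (p := p) κa ρ)).toTopRep) ∈
        Submodule.map (torsionInclH1 (bigRep (p := p) κc (bigRep (p := p) κa ρ))
            (PowerSeries.X : PowerSeries (PowerSeries 𝒪)))
          (selmer φ L (torsionRep (bigRep (p := p) κc (bigRep (p := p) κa ρ))
            (PowerSeries.X : PowerSeries (PowerSeries 𝒪))))) ∧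
      (∀ y : selmer φ L (bigRep (p := p) κc (bigRep (p := p) κa ρ)),
        (y : continuousCohomology 1 (bigRep (p := p) κc (bigRep (p := p) κa ρ)).toTopRep) ∈
          Submodule.map (torsionInclH1 (bigRep (p := p) κc (bigRep (p := p) κa ρ))
              (PowerSeries.X : PowerSeries (PowerSeries 𝒪)))
            (selmer φ L (torsionRep (bigRep (p := p) κc (bigRep (p := p) κa ρ))
              (PowerSeries.X : PowerSeries (PowerSeries 𝒪)))) →
        y ∈ Set.range θ) := by
  set M := bigRep (p := p) κa ρ with hM
  set MM := bigRep (p := p) κc (bigRep (p := p) κa ρ) with hMM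
  -- the constants equivalence `η : M ≃ₜ+ 𝓜[X]` (both sides discrete)
  let η : BigRepModule 𝒪 p A ≃ₜ+
      Submodule.torsionBy (PowerSeries (PowerSeries 𝒪))
        (BigRepModule (PowerSeries 𝒪) p (BigRepModule 𝒪 p A)) PowerSeries.X :=
    { toFun := fun m ↦ ⟨BigRepModule.mk (fun _ : ℤ_[p] ↦ m) (const_mem m), const_mem_torsionBy m⟩
      invFun := fun Φ ↦ (Φ : BigRepModule (PowerSeries 𝒪) p (BigRepModule 𝒪 p A)) 0
      left_inv := fun m ↦ by simp
      right_inv := fun Φ ↦ Subtype.ext (eq_const_of_mem_torsionBy Φ).symm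
      map_add' := fun m m' ↦ Subtype.ext (BigRepModule.ext fun x ↦ rfl)
      continuous_toFun := continuous_of_discreteTopology
      continuous_invFun := continuous_of_discreteTopology }
  -- `η` is `Γ`-equivariant: `g · const m = const (g · m)`
  have hη : ∀ (g : Γ) (m : BigRepModule 𝒪 p A),
      η (M g m) = (torsionRep MM (PowerSeries.X : PowerSeries (PowerSeries 𝒪))) g (η m) := by
    intro g m
    apply Subtype.ext
    change BigRepModule.mk (fun _ : ℤ_[p] ↦ M g m) _ = MM g (BigRepModule.mk (fun _ : ℤ_[p] ↦ m) _)
    rw [hMM, BigRepModule.bigRep_mk_const]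
  -- the scalar-blind `H¹` comparison along `η`
  let E := continuousCohomologyAddEquiv (X := M.toTopRep)
    (Y := (torsionRep MM (PowerSeries.X : PowerSeries (PowerSeries 𝒪))).toTopRep) η hη 1
  -- naturality with the restrictions along `φ v`: local conditions correspond
  have hres : ∀ (v : ι) (x : continuousCohomology 1 M.toTopRep),
      resH1 M (φ v) x = 0 ↔
        resH1 (torsionRep MM (PowerSeries.X : PowerSeries (PowerSeries 𝒪))) (φ v) (E x) = 0 := by
    intro v x
    let Ev := continuousCohomologyAddEquiv (X := (M.restrict (φ v)).toTopRep)
      (Y := ((torsionRep MM (PowerSeries.X : PowerSeries (PowerSeries 𝒪))).restrict (φ v)).toTopRep)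
      η (fun h m ↦ hη (φ v h) m) 1
    have hnat := continuousCohomologyAddEquiv_map (X := M.toTopRep)
      (X' := (torsionRep MM (PowerSeries.X : PowerSeries (PowerSeries 𝒪))).toTopRep)
      (Y := (M.restrict (φ v)).toTopRep)
      (Y' := ((torsionRep MM (PowerSeries.X : PowerSeries (PowerSeries 𝒪))).restrict (φ v)).toTopRep)
      η hη η (fun h m ↦ hη (φ v h) m) (φ v) (resMod M (φ v))
      (resMod (torsionRep MM (PowerSeries.X : PowerSeries (PowerSeries 𝒪))) (φ v)) (fun _ ↦ rfl) 1 x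
    change (resH1 M (φ v)).hom x = 0 ↔ (resH1 (torsionRep MM PowerSeries.X) (φ v)).hom (E x) = 0
    rw [← hnat]
    constructor
    · intro h0
      rw [h0, map_zero]
    · intro h0
      exact Ev.injective (by rw [h0, map_zero])
  -- naturality with the scalar endomorphisms: `E` is `C`-semilinear
  have hE_smul : ∀ (f : PowerSeries 𝒪) (x : continuousCohomology 1 M.toTopRep),
      E (f • x) = (PowerSeries.C f : PowerSeries (PowerSeries 𝒪)) • E x := by
    intro f x
    have hnat := continuousCohomologyAddEquiv_map (X := M.toTopRep)
      (X' := (torsionRep MM (PowerSeries.X : PowerSeries (PowerSeries 𝒪))).toTopRep)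
      (Y := M.toTopRep)
      (Y' := (torsionRep MM (PowerSeries.X : PowerSeries (PowerSeries 𝒪))).toTopRep)
      η hη η hη (ContinuousMonoidHom.id Γ) (resIdHom (smulHom M f))
      (resIdHom (smulHom (torsionRep MM (PowerSeries.X : PowerSeries (PowerSeries 𝒪)))
        (PowerSeries.C f : PowerSeries (PowerSeries 𝒪)))) (fun m ↦ ?_) 1 x
    · rw [← cohomologyMap_smulHom_one M f x, ← cohomologyMap_smulHom_one _ _ (E x)]
      exact hnat
    · -- on the modules: `η (f • m) = C f • η m`
      apply Subtype.ext
      change BigRepModule.mk (fun _ : ℤ_[p] ↦ f • m) _ =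
        (PowerSeries.C f : PowerSeries (PowerSeries 𝒪)) • BigRepModule.mk (fun _ : ℤ_[p] ↦ m) _
      rw [C_smul_const]
  -- the Selmer conditions correspond under `E`
  have hsel : ∀ x : continuousCohomology 1 M.toTopRep,
      x ∈ selmer φ L M ↔
        E x ∈ selmer φ L (torsionRep MM (PowerSeries.X : PowerSeries (PowerSeries 𝒪))) := by
    intro x
    rw [mem_selmer_iff, mem_selmer_iff]
    exact forall₂_congr fun v _ ↦ hres v x
  -- `H¹(ι)` is injective: `X` is onto `𝓜` and `𝓜^Γ = 0`
  have hr := ControlInputs.X_smul_surjective_iterate (𝒪 := 𝒪) (p := p) (A := A)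
  have h0 := ControlInputs.bigRep_bigRep_invariants_eq_bot (p := p) κc κa ρ hA
  have hinj := cohomologyMap_torsionIncl_injective_of_invariants_eq_bot MM
    (PowerSeries.X : PowerSeries (PowerSeries 𝒪)) hr h0
  -- the map `θ = H¹(ι) ∘ E` on Selmer groups
  let θ : selmer φ L M →+ selmer φ L MM :=
    { toFun := fun s ↦ ⟨torsionInclH1 MM (PowerSeries.X : PowerSeries (PowerSeries 𝒪)) (E s),
        cohomologyMap_mem_selmer φ L (torsionIncl MM _) ((hsel s).1 s.2)⟩
      map_zero' := Subtype.ext (by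
        change torsionInclH1 MM PowerSeries.X
          (E ((0 : selmer φ L M) : continuousCohomology 1 M.toTopRep)) = 0
        rw [Submodule.coe_zero, map_zero, map_zero])
      map_add' := fun s s' ↦ Subtype.ext (by
        change torsionInclH1 MM PowerSeries.X
            (E ((s + s' : selmer φ L M) : continuousCohomology 1 M.toTopRep)) =
          torsionInclH1 MM PowerSeries.X (E s) + torsionInclH1 MM PowerSeries.X (E s')
        rw [Submodule.coe_add, map_add, map_add]) }
  have hθ : ∀ s : selmer φ L M, ((θ s : selmer φ L MM) : continuousCohomology 1 MM.toTopRep) =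
      torsionInclH1 MM (PowerSeries.X : PowerSeries (PowerSeries 𝒪)) (E s) := fun _ ↦ rfl
  refine ⟨θ, ?_, ?_, ?_, ?_⟩
  · -- (1) injective
    intro s s' h
    have h' := congrArg (fun t : selmer φ L MM ↦ (t : continuousCohomology 1 MM.toTopRep)) h
    simp only [hθ] at h'
    exact Subtype.ext (E.injective (hinj h'))
  · -- (2) `C`-semilinear
    intro f s
    apply Subtype.ext
    rw [Submodule.coe_smul, hθ, hθ, Submodule.coe_smul, hE_smul, map_smul]
  · -- (3) valued in `H¹(ι)(Sel_L(𝓜[X]))`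
    intro s
    rw [hθ]
    exact Submodule.mem_map_of_mem ((hsel s).1 s.2)
  · -- (4) onto `H¹(ι)(Sel_L(𝓜[X]))`
    intro y hy
    obtain ⟨x, hx, hxy⟩ := hy
    have hs : E.symm x ∈ selmer φ L M := by
      rw [hsel, E.apply_symm_apply]
      exact hx
    refine ⟨⟨E.symm x, hs⟩, Subtype.ext ?_⟩
    rw [hθ, ← hxy]
    change torsionInclH1 MM PowerSeries.X (E (E.symm x)) = _
    rw [E.apply_symm_apply]

end Control

end Summit.BirchSwinnertonDyer.BirchSwinnertonDyer.Theorems.ErratumThm23TwoVariable.ControlHom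

end
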